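import Mathlib
import Summits.MatrixMultiplication.MatrixMultiplication.Theses.StrassenDefect

/-!
# `StrassenDefect.Assembly` (stmt-MatrixMultiplication-10621) — proved

The assembly item of route `MatrixMultiplication/StrassenDefect` is the implication

  `VanishingStrassenDefect → DefectInequality → MatrixMultiplication`  (`ω(ℂ) = 2`),

literally the type of the route's deciding theorem `closes`.  We give a self-contained proof of the
real-analysis bookkeeping (it follows — but does not invoke — `closes`, and avoids logarithms):

* `ω ≥ 2` is the flattening bound `omega_two_le` (tree).
* For `ω ≤ 2`: fix `ε > 0` and take the instance `(m, N, J)` of X (`m ≥ 2`, `N ≥ 1`,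
  `(m²⊙⟨N⟩) ⊕ J ⊵ ⟨mN⟩`, `R̃(J) ≤ ε·m²·N²`).  `DefectInequality` gives
  `(mN)^ω ≤ m²·N^ω + R̃(J) ≤ m²·N^ω + ε·m²·N² ≤ (1+ε)·m²·N^ω` (`N² ≤ N^ω` as `ω ≥ 2`, `N ≥ 1`);
  writing `ω = s + 2` (`s ≥ 0`) and cancelling `m²·N^ω > 0` leaves `m^s ≤ 1 + ε`, and `m ≥ 2`
  gives `2^s ≤ 1 + ε` (`two_rpow_omega_sub_two_le_of_defect`).  Letting `ε → 0`, `2^(ω-2) ≤ 1`,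
  so `ω ≤ 2`.

No item other than X and `DefectInequality` is load-bearing, exactly as the route's `## Assembly`
paragraph says.  References: V. Strassen, J. reine angew. Math. 384 (1988) (asymptotic rank
calculus); M. Bläser, *Fast Matrix Multiplication*, ToC Graduate Surveys 5 (2013), §5–§7.
-/

-- `Summit.MatrixMultiplication.MatrixMultiplication.…` is the tree's mandated summit-side namespace
-- (single-conjunct summit: Sub = Summit), which the `dupNamespace` linter would flag on every decl.
set_option linter.dupNamespace false

namespace Summit.MatrixMultiplication.MatrixMultiplication.Theorems

open Literature.Computability.AlgebraicComplexity

/-- **One defect instance bounds `2^(ω-2)`.**  If `m ≥ 2`, `N ≥ 1`,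
`(mN)^ω ≤ m²·N^ω + R` (the defect inequality for some junk of asymptotic rank `R`) and
`R ≤ ε·(m²·N²)` with `ε ≥ 0`, then `2^(ω(ℂ)-2) ≤ 1 + ε`:
`m^s·m²·N^ω = (mN)^ω ≤ m²·N^ω + ε·m²·N² ≤ (1+ε)·m²·N^ω` with `ω = s + 2`, `s ≥ 0`, `N² ≤ N^ω`;
cancel `m²·N^ω > 0` and use `2^s ≤ m^s`.  Pure real-analysis bookkeeping. [folklore] -/
theorem two_rpow_omega_sub_two_le_of_defect {m N : ℕ} {ε R : ℝ} (hm : 2 ≤ m) (hN : 1 ≤ N)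
    (hineq : ((m : ℝ) * N) ^ omega ℂ ≤ (m : ℝ) ^ 2 * (N : ℝ) ^ omega ℂ + R)
    (hR : R ≤ ε * ((m : ℝ) ^ 2 * (N : ℝ) ^ 2)) (hε : 0 ≤ ε) :
    (2 : ℝ) ^ (omega ℂ - 2) ≤ 1 + ε := by
  obtain ⟨s, hω⟩ : ∃ s : ℝ, omega ℂ = s + 2 := ⟨omega ℂ - 2, by ring⟩
  have h2 : (2 : ℝ) ≤ omega ℂ := omega_two_le ℂ
  have hs : 0 ≤ s := by linarith
  have hm2 : (2 : ℝ) ≤ m := by exact_mod_cast hm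
  have hm0 : (0 : ℝ) < m := by linarith
  have hN1 : (1 : ℝ) ≤ N := by exact_mod_cast hN
  have hN0 : (0 : ℝ) < N := by linarith
  -- `N² ≤ N^ω`
  have hNsq : (N : ℝ) ^ 2 ≤ (N : ℝ) ^ omega ℂ := by
    calc (N : ℝ) ^ 2 = (N : ℝ) ^ ((2 : ℕ) : ℝ) := (Real.rpow_natCast _ 2).symm
      _ ≤ (N : ℝ) ^ omega ℂ := Real.rpow_le_rpow_of_exponent_le hN1 (by push_cast; exact h2)
  -- `(mN)^ω ≤ (1+ε)·m²·N^ω`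
  have h1 : ((m : ℝ) * N) ^ omega ℂ ≤ (1 + ε) * ((m : ℝ) ^ 2 * (N : ℝ) ^ omega ℂ) := by
    have hmono : ε * ((m : ℝ) ^ 2 * (N : ℝ) ^ 2) ≤ ε * ((m : ℝ) ^ 2 * (N : ℝ) ^ omega ℂ) :=
      mul_le_mul_of_nonneg_left (mul_le_mul_of_nonneg_left hNsq (sq_nonneg _)) hε
    linarith
  -- `(mN)^ω = m^s · (m² · N^ω)`
  have hms : (m : ℝ) ^ omega ℂ = (m : ℝ) ^ s * (m : ℝ) ^ 2 := by
    rw [hω, Real.rpow_add hm0, Real.rpow_two]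
  have h3 : ((m : ℝ) * N) ^ omega ℂ = (m : ℝ) ^ s * ((m : ℝ) ^ 2 * (N : ℝ) ^ omega ℂ) := by
    rw [Real.mul_rpow hm0.le hN0.le, hms]
    ring
  rw [h3] at h1
  -- cancel the positive factor `m² · N^ω`
  have hP : (0 : ℝ) < (m : ℝ) ^ 2 * (N : ℝ) ^ omega ℂ := by positivity
  have h4 : (m : ℝ) ^ s ≤ 1 + ε := le_of_mul_le_mul_right h1 hP
  -- `2^s ≤ m^s`
  have h5 : (2 : ℝ) ^ s ≤ (m : ℝ) ^ s := Real.rpow_le_rpow zero_le_two hm2 hs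
  rw [hω, add_sub_cancel_right]
  exact h5.trans h4

/-- **Assembly of route `StrassenDefect` (stmt-MatrixMultiplication-10621), exact signature
`VanishingStrassenDefect → DefectInequality → MatrixMultiplication`.**  For every `ε > 0` the
instance `(m, N, J)` of the vanishing Strassen defect, fed through `DefectInequality`
(`(mN)^ω ≤ m²·N^ω + R̃(J)`, `R̃(J) ≤ ε·m²·N²`), gives `2^(ω-2) ≤ 1 + ε`
(`two_rpow_omega_sub_two_le_of_defect`); hence `2^(ω-2) ≤ 1`, so `ω ≤ 2` (`1 < 2^(ω-2)` if
`ω > 2`), while `ω ≥ 2` is the flattening bound `omega_two_le`.  Hence `ω(ℂ) = 2`. [folklore] -/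
theorem strassenDefect_assembly_proof :
    Summit.MatrixMultiplication.MatrixMultiplication.Theses.StrassenDefect.Assembly := by
  unfold Summit.MatrixMultiplication.MatrixMultiplication.Theses.StrassenDefect.Assembly
    Summit.MatrixMultiplication.MatrixMultiplication.Theses.StrassenDefect.VanishingStrassenDefect
    Summit.MatrixMultiplication.MatrixMultiplication.Theses.StrassenDefect.DefectInequality
  intro hX hD
  show omega ℂ = 2
  have h2 : (2 : ℝ) ≤ omega ℂ := omega_two_le ℂ
  refine le_antisymm ?_ h2
  have key : ∀ ε : ℝ, 0 < ε → (2 : ℝ) ^ (omega ℂ - 2) ≤ 1 + ε := fun ε hε => by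
    obtain ⟨m, N, a, b, c, hm, hN, J, hdeg, hJ⟩ := hX ε hε
    exact two_rpow_omega_sub_two_le_of_defect hm hN
      (hD m N a b c (le_trans one_le_two hm) hN J hdeg) hJ hε.le
  have hle : (2 : ℝ) ^ (omega ℂ - 2) ≤ 1 := le_of_forall_pos_le_add fun ε hε => key ε hε
  by_contra hcon
  have hlt : 0 < omega ℂ - 2 := by linarith [lt_of_not_ge hcon]
  have h1 : (1 : ℝ) < (2 : ℝ) ^ (omega ℂ - 2) := Real.one_lt_rpow one_lt_two hlt
  linarith

end Summit.MatrixMultiplication.MatrixMultiplication.Theorems
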